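import Summits.AtomisticToContinuum.FouriersLaw.Theorems.BondHeatUncertaintyBoundedResponseTailSignA

/-!
# `BondHeatUncertainty.BoundedResponse` (11071) — NODE g97 «TailSign», part B (continuation of `…TailSignA`)

§3 the survival profile (sign-free facts; the budget and the WINDOW LEMMA under `SurvivalSign`; `SurvivalSign → WindowSurvivalPoint`) and
§4 `CoolingSign → SurvivalSign`.  Setting, grading, tags and the honest score: see the module docstring of part A.  0 sorry, no new axioms.
-/

noncomputable section

open MeasureTheory ProbabilityTheory Filter Topology Set Function
open scoped NNReal ENNReal
open Literature.MathematicalPhysics.KineticTheory.HeatConduction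
open Literature.MathematicalPhysics.KineticTheory OscillatorChain
open Summit.AtomisticToContinuum.FouriersLaw.Theorems.SubdiffusiveBondHeat
open Summit.AtomisticToContinuum.FouriersLaw.Theorems.OddSectorIrreversibility
open Summit.AtomisticToContinuum.FouriersLaw.Theorems.BoundedResponse.TransientBand

namespace Summit.AtomisticToContinuum.FouriersLaw.Theorems.BoundedResponse.ParityFloor

open Summit.AtomisticToContinuum.FouriersLaw.Theses.BondHeatUncertainty (BoundedResponse)
open Summit.AtomisticToContinuum.FouriersLaw.Theses.GriffithsLimitExchange (BoundaryDEP FiniteHorizonTransmission)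
open Summit.AtomisticToContinuum.FouriersLaw.Theorems.SubdiffusiveBondHeat.EscapeGrading
  (escapeDeficit OhmicFloor ohmicFloor_iff_boundedResponse)

section TailSign

variable {ω₂ lam β γ T : ℝ} {N : ℕ}

/-! ## §3 The survival profile: sign-free facts, and the budget under `SurvivalSign` alone -/

/-- Splitting `(0,∞) = (0,t] ∪ (t,∞)` for the far kernel. [formal bookkeeping] -/
theorem integral_crossKernel_split (hω : 0 < ω₂) (hl : 0 < lam) (hβ : 0 < β) (hγ : 0 < γ) (hT : 0 < T) (N : ℕ)
    {t : ℝ} (ht : 0 ≤ t) :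
    ∫ u in Ioi 0, crossKernel ω₂ lam β γ T N u =
      (∫ u in Ioc 0 t, crossKernel ω₂ lam β γ T N u) + ∫ u in Ioi t, crossKernel ω₂ lam β γ T N u := by
  have hKti := integrableOn_crossKernel hω hl hβ hγ hT N
  rw [← setIntegral_union Ioc_disjoint_Ioi_same measurableSet_Ioi (hKti.mono_set Ioc_subset_Ioi_self)
    (hKti.mono_set (Ioi_subset_Ioi ht)), Ioc_union_Ioi_eq_Ioi ht]

/-- Splitting `(0,∞) = (0,t] ∪ (t,∞)` for the near kernel. [formal bookkeeping] -/
theorem integral_escapeKernel_split (hω : 0 < ω₂) (hl : 0 < lam) (hβ : 0 < β) (hγ : 0 < γ) (hT : 0 < T) (N : ℕ)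
    {t : ℝ} (ht : 0 ≤ t) :
    ∫ u in Ioi 0, escapeKernel ω₂ lam β γ T N u =
      (∫ u in Ioc 0 t, escapeKernel ω₂ lam β γ T N u) + ∫ u in Ioi t, escapeKernel ω₂ lam β γ T N u := by
  have hKi := integrableOn_escapeKernel hω hl hβ hγ hT N
  rw [← setIntegral_union Ioc_disjoint_Ioi_same measurableSet_Ioi (hKi.mono_set Ioc_subset_Ioi_self)
    (hKi.mono_set (Ioi_subset_Ioi ht)), Ioc_union_Ioi_eq_Ioi ht]

/-- `S_N` is continuous on `[0,b]` (`N ≥ 2`): `S_N = 1 − θ_N − φ_N` there, `θ_N` continuous, `φ_N` a primitive of an `L¹` kernel.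
[folklore] -/
theorem continuousOn_survival_Icc (hω : 0 < ω₂) (hl : 0 < lam) (hβ : 0 < β) (hγ : 0 < γ) (hN : 2 ≤ N) (hT : 0 < T)
    {b : ℝ} (hb : 0 ≤ b) : ContinuousOn (survival ω₂ lam β γ T N) (Icc 0 b) := by
  have hKti := integrableOn_crossKernel hω hl hβ hγ hT N
  have hφ : ContinuousOn (fun s => ∫ u in (0 : ℝ)..s, crossKernel ω₂ lam β γ T N u) (uIcc 0 b) :=
    intervalIntegral.continuousOn_primitive_interval'
      ((intervalIntegrable_iff_integrableOn_Ioc_of_le hb).2 (hKti.mono_set Ioc_subset_Ioi_self)) left_mem_uIcc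
  rw [uIcc_of_le hb] at hφ
  have hc : ContinuousOn (fun s => 1 - stepResponse ω₂ lam β γ T N s -
      γ / T ^ 2 * ∫ u in (0 : ℝ)..s, crossKernel ω₂ lam β γ T N u) (Icc 0 b) :=
    (continuousOn_const.sub (continuous_stepResponse hω hl hβ hγ hT N).continuousOn).sub (continuousOn_const.mul hφ)
  exact hc.congr fun s hs => survival_eq hω hl hβ hγ hN hT hs.1

/-- `S_N` is interval-integrable on `[a,b] ⊆ [0,∞)`. [formal bookkeeping] -/
theorem intervalIntegrable_survival (hω : 0 < ω₂) (hl : 0 < lam) (hβ : 0 < β) (hγ : 0 < γ) (hN : 2 ≤ N) (hT : 0 < T)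
    {a b : ℝ} (ha : 0 ≤ a) (hab : a ≤ b) : IntervalIntegrable (survival ω₂ lam β γ T N) volume a b :=
  ((continuousOn_survival_Icc hω hl hβ hγ hN hT (ha.trans hab)).mono (Icc_subset_Icc_left ha)).intervalIntegrable_of_Icc hab

/-- `S_N(0) = 1` (`N ≥ 2`): all of the injected energy is in the chain at time `0` (exit identity). [folklore] -/
theorem survival_zero (hω : 0 < ω₂) (hl : 0 < lam) (hβ : 0 < β) (hγ : 0 < γ) (hN : 2 ≤ N) (hT : 0 < T) :
    survival ω₂ lam β γ T N 0 = 1 := by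
  rw [survival_eq hω hl hβ hγ hN hT le_rfl, stepResponse, intervalIntegral.integral_same, intervalIntegral.integral_same]
  ring

/-- `S_N(t) → 0` as `t → ∞` (`N ≥ 2`): everything injected eventually exits (`θ_N(t) → 1 − E_N`, `φ_N(t) → E_N`). [new] -/
theorem tendsto_survival_atTop (hω : 0 < ω₂) (hl : 0 < lam) (hβ : 0 < β) (hγ : 0 < γ) (hN : 2 ≤ N) (hT : 0 < T) :
    Tendsto (survival ω₂ lam β γ T N) atTop (𝓝 0) := by
  have hKi := integrableOn_escapeKernel hω hl hβ hγ hT N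
  have hKti := integrableOn_crossKernel hω hl hβ hγ hT N
  have hθ : Tendsto (fun s => ∫ u in (0 : ℝ)..s, escapeKernel ω₂ lam β γ T N u) atTop
      (𝓝 (∫ u in Ioi 0, escapeKernel ω₂ lam β γ T N u)) :=
    intervalIntegral_tendsto_integral_Ioi 0 hKi tendsto_id
  have hφ : Tendsto (fun s => ∫ u in (0 : ℝ)..s, crossKernel ω₂ lam β γ T N u) atTop
      (𝓝 (∫ u in Ioi 0, crossKernel ω₂ lam β γ T N u)) :=
    intervalIntegral_tendsto_integral_Ioi 0 hKti tendsto_id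
  have hlim : Tendsto (fun s => 1 - γ / T ^ 2 * (∫ u in (0 : ℝ)..s, escapeKernel ω₂ lam β γ T N u) -
      γ / T ^ 2 * ∫ u in (0 : ℝ)..s, crossKernel ω₂ lam β γ T N u) atTop
      (𝓝 (1 - γ / T ^ 2 * (∫ u in Ioi 0, escapeKernel ω₂ lam β γ T N u) -
        γ / T ^ 2 * ∫ u in Ioi 0, crossKernel ω₂ lam β γ T N u)) :=
    (tendsto_const_nhds.sub (hθ.const_mul _)).sub (hφ.const_mul _)
  have key : 1 - γ / T ^ 2 * (∫ u in Ioi 0, escapeKernel ω₂ lam β γ T N u) -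
      γ / T ^ 2 * ∫ u in Ioi 0, crossKernel ω₂ lam β γ T N u = 0 := by
    rw [← escapeDeficit_eq ω₂ lam β γ T N, escapeDeficit_eq_integral_crossKernel hω hl hβ hγ hN hT, sub_self]
  rw [key] at hlim
  refine hlim.congr' ?_
  filter_upwards [eventually_ge_atTop (0 : ℝ)] with s hs
  rw [survival_eq hω hl hβ hγ hN hT hs, stepResponse]

/-- `S^{stor}_N` is non-decreasing on `[0,∞)` whenever `S_N ≥ 0` there (`N ≥ 2`; first law `S^{stor}_N(t) = ∫₀ᵗ S_N`). [folklore] -/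
theorem storageResponse_mono_of_survival_nonneg (hω : 0 < ω₂) (hl : 0 < lam) (hβ : 0 < β) (hγ : 0 < γ) (hN : 2 ≤ N)
    (hT : 0 < T) (hS : ∀ s : ℝ, 0 ≤ s → 0 ≤ survival ω₂ lam β γ T N s) {t t' : ℝ} (ht : 0 ≤ t) (htt' : t ≤ t') :
    storageResponse ω₂ lam β γ T N t ≤ storageResponse ω₂ lam β γ T N t' := by
  rw [storageResponse_eq_integral_survival hω hl hβ hγ hN hT ht,
    storageResponse_eq_integral_survival hω hl hβ hγ hN hT (ht.trans htt'),
    ← intervalIntegral.integral_add_adjacent_intervals (intervalIntegrable_survival hω hl hβ hγ hN hT le_rfl ht)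
      (intervalIntegrable_survival hω hl hβ hγ hN hT ht htt')]
  exact le_add_of_nonneg_right (intervalIntegral.integral_nonneg htt' fun s hs => hS s (ht.trans hs.1))

/-- **`S^{stor}_N(t) ≤ Var_T(H_N)/(2γT²)` for every `t ≥ 0` under the survival sign alone** (`N ≥ 2`): `S^{stor}_N` is then
non-decreasing and tends to `Λ_N/T² = Var_T(H_N)/(2γT²)` (tree sum rule); no pointwise kernel sign and no monotonicity of `S_N`
is used. [new] -/
theorem storageResponse_le_variance_of_survival_nonneg (hω : 0 < ω₂) (hl : 0 < lam) (hβ : 0 < β) (hγ : 0 < γ)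
    (hN : 2 ≤ N) (hT : 0 < T) (hS : ∀ s : ℝ, 0 ≤ s → 0 ≤ survival ω₂ lam β γ T N s) {t : ℝ} (ht : 0 ≤ t) :
    storageResponse ω₂ lam β γ T N t ≤ energyVariance ω₂ lam β γ T N / (2 * γ * T ^ 2) := by
  have hlim := tendsto_storageResponse hω hl hβ hγ (by omega : 0 < N) hT
  rw [energyPairing_eq_half_variance hω hl hβ hγ hN hT, div_div] at hlim
  exact ge_of_tendsto hlim ((eventually_ge_atTop t).mono fun t' htt' =>
    storageResponse_mono_of_survival_nonneg hω hl hβ hγ hN hT hS ht htt')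

/-- `∫ₐ^{2a} S_N ≤ Var_T(H_N)/(2γT²)` for `a ≥ 0` under the survival sign (`N ≥ 2`). [new] -/
theorem integral_window_survival_le (hω : 0 < ω₂) (hl : 0 < lam) (hβ : 0 < β) (hγ : 0 < γ) (hN : 2 ≤ N) (hT : 0 < T)
    (hS : ∀ s : ℝ, 0 ≤ s → 0 ≤ survival ω₂ lam β γ T N s) {a : ℝ} (ha : 0 ≤ a) :
    ∫ s in a..(2 * a), survival ω₂ lam β γ T N s ≤ energyVariance ω₂ lam β γ T N / (2 * γ * T ^ 2) := by
  have h2a : a ≤ 2 * a := by linarith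
  have hsplit : ∫ s in a..(2 * a), survival ω₂ lam β γ T N s =
      storageResponse ω₂ lam β γ T N (2 * a) - storageResponse ω₂ lam β γ T N a := by
    rw [storageResponse_eq_integral_survival hω hl hβ hγ hN hT ha,
      storageResponse_eq_integral_survival hω hl hβ hγ hN hT (ha.trans h2a),
      ← intervalIntegral.integral_add_adjacent_intervals (intervalIntegrable_survival hω hl hβ hγ hN hT le_rfl ha)
        (intervalIntegrable_survival hω hl hβ hγ hN hT ha h2a)]
    ring
  have hpos : 0 ≤ storageResponse ω₂ lam β γ T N a := by
    rw [storageResponse_eq_integral_survival hω hl hβ hγ hN hT ha]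
    exact intervalIntegral.integral_nonneg ha fun s hs => hS s hs.1
  have hle := storageResponse_le_variance_of_survival_nonneg hω hl hβ hγ hN hT hS (ha.trans h2a)
  rw [hsplit]
  linarith

/-- **Window lemma**: under the survival sign, for every `a > 0` some `t ∈ [a, 2a]` has `S_N(t) ≤ Var_T(H_N)/(2γT²·a)`
(the minimum of the continuous `S_N` on `[a,2a]` is at most its mean; `N ≥ 2`). [new] -/
theorem exists_window_survival_le (hω : 0 < ω₂) (hl : 0 < lam) (hβ : 0 < β) (hγ : 0 < γ) (hN : 2 ≤ N) (hT : 0 < T)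
    (hS : ∀ s : ℝ, 0 ≤ s → 0 ≤ survival ω₂ lam β γ T N s) {a : ℝ} (ha : 0 < a) :
    ∃ t ∈ Icc a (2 * a), survival ω₂ lam β γ T N t ≤ energyVariance ω₂ lam β γ T N / (2 * γ * T ^ 2 * a) := by
  have h2a : a ≤ 2 * a := by linarith
  have hc : ContinuousOn (survival ω₂ lam β γ T N) (Icc a (2 * a)) :=
    (continuousOn_survival_Icc hω hl hβ hγ hN hT (ha.le.trans h2a)).mono (Icc_subset_Icc_left ha.le)
  obtain ⟨t, ht, hmin⟩ := isCompact_Icc.exists_isMinOn (nonempty_Icc.2 h2a) hc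
  refine ⟨t, ht, ?_⟩
  have hI : IntervalIntegrable (survival ω₂ lam β γ T N) volume a (2 * a) :=
    intervalIntegrable_survival hω hl hβ hγ hN hT ha.le h2a
  have hconst : ∫ _ in a..(2 * a), survival ω₂ lam β γ T N t = a * survival ω₂ lam β γ T N t := by
    rw [intervalIntegral.integral_const, smul_eq_mul]
    ring
  have hmono : ∫ _ in a..(2 * a), survival ω₂ lam β γ T N t ≤ ∫ s in a..(2 * a), survival ω₂ lam β γ T N s :=
    intervalIntegral.integral_mono_on h2a intervalIntegrable_const hI fun s hs => (isMinOn_iff.1 hmin) s hs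
  rw [hconst] at hmono
  have hmain : a * survival ω₂ lam β γ T N t ≤ energyVariance ω₂ lam β γ T N / (2 * γ * T ^ 2) :=
    hmono.trans (integral_window_survival_le hω hl hβ hγ hN hT hS ha.le)
  rw [le_div_iff₀ (by positivity : (0 : ℝ) < 2 * γ * T ^ 2)] at hmain
  rw [le_div_iff₀ (by positivity : (0 : ℝ) < 2 * γ * T ^ 2 * a)]
  calc survival ω₂ lam β γ T N t * (2 * γ * T ^ 2 * a) = a * survival ω₂ lam β γ T N t * (2 * γ * T ^ 2) := by ring
    _ ≤ energyVariance ω₂ lam β γ T N := hmain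

/-- **Tail-sign substitute for 13200 ⟸ 13198**: under `SurvivalSign` there is `C` (`= |C_V|/(2γT²)`) such that for every horizon
constant `A > 0` and every `N ≥ 2` some `t ∈ [A·N², 2A·N²]` has `N·S_N(t) ≤ C/A` (the point form `N·S_N(A·N²) ≤ ε` of
`VanishingSurvival` needs `S_N` antitone, i.e. the pointwise sum sign). [new] -/
theorem exists_window_survival_small (hS : SurvivalSign) (hω : 0 < ω₂) (hl : 0 < lam) (hβ : 0 < β) (hγ : 0 < γ)
    (hT : 0 < T) :
    ∃ C : ℝ, 0 ≤ C ∧ ∀ A : ℝ, 0 < A → ∀ N : ℕ, 2 ≤ N →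
      ∃ t ∈ Icc (A * (N : ℝ) ^ 2) (2 * (A * (N : ℝ) ^ 2)), (N : ℝ) * survival ω₂ lam β γ T N t ≤ C / A := by
  obtain ⟨C, hC⟩ := energyFluctuationExtensive_holds ω₂ lam β γ hω hl hβ hγ T hT
  refine ⟨|C| / (2 * γ * T ^ 2), by positivity, fun A hA N hN => ?_⟩
  have hNpos : (0 : ℝ) < N := by exact_mod_cast (show 0 < N by omega)
  have ha : (0 : ℝ) < A * (N : ℝ) ^ 2 := by positivity
  have hSN : ∀ s : ℝ, 0 ≤ s → 0 ≤ survival ω₂ lam β γ T N s := fun s hs => hS ω₂ lam β γ hω hl hβ hγ T hT N s hN hs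
  obtain ⟨t, ht, hSt⟩ := exists_window_survival_le hω hl hβ hγ hN hT hSN ha
  refine ⟨t, ht, ?_⟩
  have hV : energyVariance ω₂ lam β γ T N ≤ |C| * N := (hC N).trans (by gcongr; exact le_abs_self C)
  have hγ0 : γ ≠ 0 := hγ.ne'
  have hT0 : T ≠ 0 := hT.ne'
  have hA0 : A ≠ 0 := hA.ne'
  have hN0 : (N : ℝ) ≠ 0 := hNpos.ne'
  calc (N : ℝ) * survival ω₂ lam β γ T N t
      ≤ (N : ℝ) * (energyVariance ω₂ lam β γ T N / (2 * γ * T ^ 2 * (A * (N : ℝ) ^ 2))) :=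
        mul_le_mul_of_nonneg_left hSt hNpos.le
    _ ≤ (N : ℝ) * (|C| * N / (2 * γ * T ^ 2 * (A * (N : ℝ) ^ 2))) := by gcongr
    _ = |C| / (2 * γ * T ^ 2) / A := by field_simp

/-- **`SurvivalSign → WindowSurvivalPoint`** (constant `|C_V|/(2γT²A)`, all `N ≥ 2`). [new] -/
theorem windowSurvivalPoint_of_survivalSign : SurvivalSign → WindowSurvivalPoint := by
  intro hS ω₂ lam β γ hω hl hβ hγ T hT A hA
  obtain ⟨C, -, hwin⟩ := exists_window_survival_small hS hω hl hβ hγ hT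
  exact ⟨C / A, (eventually_ge_atTop 2).mono fun N hN => hwin A hA N hN⟩

/-! ## §4 `CoolingSign → SurvivalSign`: one covariance controls the survival sign -/

/-- `S^{stor}_N(t) = T⁻² ∫₀ᵗ g_N` in the `storageKernel` name (`N ≥ 1`, `t ≥ 0`). [formal bookkeeping] -/
theorem storageResponse_eq_intervalIntegral_storageKernel (hω : 0 < ω₂) (hl : 0 < lam) (hβ : 0 < β) (hγ : 0 < γ)
    (hN : 0 < N) (hT : 0 < T) {t : ℝ} (ht : 0 ≤ t) :
    storageResponse ω₂ lam β γ T N t = 1 / T ^ 2 * ∫ s in (0 : ℝ)..t, storageKernel ω₂ lam β γ T N s := by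
  rw [storageResponse_eq_intervalIntegral hω hl hβ hγ hN hT ht]
  congr 1
  refine intervalIntegral.integral_congr fun s _ => ?_
  simp only [storageKernel, dif_pos hN]

/-- `∫ₜ^{t'} S_N = T⁻² ∫ₜ^{t'} g_N` for `0 ≤ t ≤ t'` (`N ≥ 2`): first law in survival form + storage in response form. [new] -/
theorem integral_survival_eq_integral_storageKernel (hω : 0 < ω₂) (hl : 0 < lam) (hβ : 0 < β) (hγ : 0 < γ) (hN : 2 ≤ N)
    (hT : 0 < T) {t t' : ℝ} (ht : 0 ≤ t) (htt' : t ≤ t') :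
    ∫ s in t..t', survival ω₂ lam β γ T N s = 1 / T ^ 2 * ∫ s in t..t', storageKernel ω₂ lam β γ T N s := by
  have hN0 : 0 < N := by omega
  have hgi : ∀ b : ℝ, 0 ≤ b → IntervalIntegrable (storageKernel ω₂ lam β γ T N) volume 0 b := fun b hb =>
    (intervalIntegrable_iff_integrableOn_Ioc_of_le hb).2
      ((integrableOn_storageKernel hω hl hβ hγ hN0 hT).mono_set Ioc_subset_Ioi_self)
  have hS1 := storageResponse_eq_integral_survival hω hl hβ hγ hN hT ht
  have hS2 := storageResponse_eq_integral_survival hω hl hβ hγ hN hT (ht.trans htt')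
  have hg1 := storageResponse_eq_intervalIntegral_storageKernel hω hl hβ hγ hN0 hT ht
  have hg2 := storageResponse_eq_intervalIntegral_storageKernel hω hl hβ hγ hN0 hT (ht.trans htt')
  have eS : ∫ s in t..t', survival ω₂ lam β γ T N s =
      (∫ s in (0 : ℝ)..t', survival ω₂ lam β γ T N s) - ∫ s in (0 : ℝ)..t, survival ω₂ lam β γ T N s := by
    rw [← intervalIntegral.integral_add_adjacent_intervals (intervalIntegrable_survival hω hl hβ hγ hN hT le_rfl ht)
      (intervalIntegrable_survival hω hl hβ hγ hN hT ht htt')]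
    ring
  have eg : ∫ s in t..t', storageKernel ω₂ lam β γ T N s =
      (∫ s in (0 : ℝ)..t', storageKernel ω₂ lam β γ T N s) - ∫ s in (0 : ℝ)..t, storageKernel ω₂ lam β γ T N s := by
    rw [← intervalIntegral.integral_add_adjacent_intervals (hgi t ht) ((hgi t' (ht.trans htt')).mono_set ?_)]
    · ring
    · rw [uIcc_of_le htt', uIcc_of_le (ht.trans htt')]
      exact Icc_subset_Icc_left ht
  rw [eS, eg, ← hS1, ← hS2, hg1, hg2]
  ring

/-- **`CoolingSign`-type hypothesis ⟹ survival sign, at fixed `N ≥ 2`**: if `g_N ≥ 0` on `[0,∞)` then `S_N ≥ 0` on `[0,∞)`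
(`∫ₜ^{t'} S_N = T⁻²∫ₜ^{t'} g_N ≥ 0` for all `0 ≤ t ≤ t'` and `S_N` is continuous). [new] -/
theorem survival_nonneg_of_storageKernel_nonneg (hω : 0 < ω₂) (hl : 0 < lam) (hβ : 0 < β) (hγ : 0 < γ) (hN : 2 ≤ N)
    (hT : 0 < T) (hg : ∀ s : ℝ, 0 ≤ s → 0 ≤ storageKernel ω₂ lam β γ T N s) {t : ℝ} (ht : 0 ≤ t) :
    0 ≤ survival ω₂ lam β γ T N t := by
  by_contra hneg
  rw [not_le] at hneg
  set S := survival ω₂ lam β γ T N with hSdef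
  -- continuity of `S` at `t` within `[0, t+1]`
  have hc : ContinuousWithinAt S (Icc 0 (t + 1)) t :=
    continuousOn_survival_Icc hω hl hβ hγ hN hT (by linarith) t ⟨ht, by linarith⟩
  rw [Metric.continuousWithinAt_iff] at hc
  obtain ⟨δ, hδ, hδc⟩ := hc (-(S t) / 2) (by linarith)
  set t' := min (t + δ / 2) (t + 1) with ht'
  have htt' : t < t' := by
    rw [ht']
    exact lt_min (by linarith) (by linarith)
  have hle' : t' ≤ t + 1 := min_le_right _ _
  have hle'' : t' ≤ t + δ / 2 := min_le_left _ _
  -- on `[t, t']` the survival stays below `S t / 2 < 0`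
  have hbound : ∀ s ∈ Icc t t', S s ≤ S t / 2 := by
    intro s hs
    have hs01 : s ∈ Icc 0 (t + 1) := ⟨ht.trans hs.1, hs.2.trans hle'⟩
    have hdist : dist s t < δ := by
      rw [Real.dist_eq, abs_of_nonneg (by linarith [hs.1])]
      linarith [hs.2]
    have h := hδc hs01 hdist
    rw [Real.dist_eq] at h
    have := (abs_lt.1 h).2
    linarith
  have hI : IntervalIntegrable S volume t t' := intervalIntegrable_survival hω hl hβ hγ hN hT ht htt'.le
  have hint_le : ∫ s in t..t', S s ≤ ∫ _ in t..t', S t / 2 :=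
    intervalIntegral.integral_mono_on htt'.le hI intervalIntegrable_const fun s hs => hbound s hs
  have hconst : ∫ _ in t..t', S t / 2 = (t' - t) * (S t / 2) := by
    rw [intervalIntegral.integral_const, smul_eq_mul]
  have hlt : ∫ s in t..t', S s < 0 := by
    rw [hconst] at hint_le
    have : (t' - t) * (S t / 2) < 0 := mul_neg_of_pos_of_neg (by linarith) (by linarith)
    linarith
  -- but the integral is `T⁻² ∫ g ≥ 0`
  have hge : 0 ≤ ∫ s in t..t', S s := by
    rw [hSdef, integral_survival_eq_integral_storageKernel hω hl hβ hγ hN hT ht htt'.le]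
    exact mul_nonneg (by positivity) (intervalIntegral.integral_nonneg htt'.le fun s hs => hg s (ht.trans hs.1))
  linarith

/-- **`CoolingSign → SurvivalSign`.** [new] -/
theorem survivalSign_of_coolingSign : CoolingSign → SurvivalSign :=
  fun hg ω₂ lam β γ hω hl hβ hγ T hT N _ hN ht =>
    survival_nonneg_of_storageKernel_nonneg hω hl hβ hγ hN hT (fun s hs => hg ω₂ lam β γ hω hl hβ hγ T hT N s hN hs) ht

end TailSign

end Summit.AtomisticToContinuum.FouriersLaw.Theorems.BoundedResponse.ParityFloor

end
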